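import Literature.Topology.FourManifolds.CodimTwoNormalPartner
import Literature.Topology.FourManifolds.SphereEmbeddingNormalTube
import Mathlib.Geometry.Manifold.SmoothApprox
import Mathlib.Geometry.Manifold.Metrizable
import HarnessLib

/-!
# Kirby's Theorem VIII.2 for `Mⁿ ⊆ S^{n+2}`: the normal bundle of a closed oriented codimension-two submanifold of a sphere is trivial

Topic `Literature/Topology/FourManifolds`; fourth file of the generalisation of the tree's 2-knot
pipeline from the round `S²` (`TwoKnotNormalEuler.lean`, Kirby's Thm. VIII.2 for `S² ⊆ S⁴`) to an
**abstract compact oriented manifold** `M` (charted on `ℝⁿ`) smoothly embedded in the round sphere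
`f : M → 𝕊ⁿ⁺²`. We **prove** (R. C. Kirby, *The Topology of 4-Manifolds* (1989), Ch. VIII,
Thm. 2, p. 44, for `Q = S^{n+2}` where `[M] = 0 ∈ H_n(Q; ℤ)` is automatic):

* `exists_isNormalFraming_one_of_embedding` — `f` admits a `C^∞` vector field tangent to `𝕊ⁿ⁺²`
  and nowhere tangent to `f` (a nowhere-zero cross-section of the normal bundle: "`χ(ν) = 0`");
* `exists_isNormalFraming_two_of_embedding` — **`f` admits a normal `2`-framing**
  (`Literature.Topology.FourManifolds.IsNormalFraming (𝓡 n) f fr`, `fr : Fin 2 → M → ℝⁿ⁺³`), i.e.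
  the normal bundle of `f` is trivial ("Since the normal bundle `ν` is oriented, it is enough to
  find a non-zero cross-section").

## The argument (Kirby's proof, pp. 44–45, made elementary — verbatim the tree's argument for `S²`)

Kirby: pull `ν` back over its total space `E(ν) ≅ N` (a tubular neighbourhood of `M` in `Q`);
off `M` the tautological section and the orientation trivialise the pull-back, so it extends by
the trivial bundle to a plane bundle `ξ` over `Q` with `ξ|_M = ν`; then `χ(ξ)` is Poincaré dual to
`[M] = 0`. As in `TwoKnotNormalEuler.lean` we realise `ξ` concretely as a continuous field of
idempotents of `ℝⁿ⁺³ × ℝ²` over `S^{n+2}` (`planeField`: the normal projection `Q_{x(z)}` at the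
nearest point within `δ/2` of `f(M)`, the trivial plane `0 × ℝ²` beyond `δ`, and on the collar the
plane spanned by `cos θ (w/‖w‖, 0) + sin θ (0, e₀)`, `cos θ (Jw, 0) + sin θ (0, e₁)` with `w` the
normal part of `z` — the tautological section — and `J` the rotation by a right angle in the
oriented normal plane, `CodimTwoNormalPartner.lean`), and replace the last (cohomological)
sentence by the remark that `f(M)` misses a pair of antipodal points `±a`
(`exists_notMem_range_neg_notMem_range`) and that along the spherical chords from `a` any vector
fixed by `P_a` is transported, in finitely many projection steps, to a nonzero vector fixed by
`P_{f x} = Q_x ⊕ 0`, continuously in `x` (`exists_continuous_section`,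
`exists_continuous_normal_of_embedding`); smoothing and re-projecting gives the smooth normal field,
and the partner field of `CodimTwoNormalPartner.lean` (continuous), smoothed and re-projected onto
the orthogonal complement of the first field inside `ν`, gives the second.

The tubular neighbourhood (nearest points, `SphereEmbeddingNormalTube.lean` over the tree's
`NormalRetraction.lean`), the smooth normal projection field (`SphereImmersionNormalField.lean`
over the tree's `contMDiff_tangentProj`) and the oriented partner (`CodimTwoNormalPartner.lean`
over the tree's `OrientationSign.lean`) are the inputs that were specific to the round `S²` in the
tree's version.

Everything here is proved; no named facts are introduced (D-0026).

## References

* R. C. Kirby, *The Topology of 4-Manifolds*, LNM 1374, Springer (1989), Ch. VIII, Thm. 2 and its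
  proof, pp. 44–45. [Kirby1989]
* M. W. Hirsch, *Differential Topology*, GTM 33, Springer (1976), Ch. 4, §5 (tubular
  neighbourhoods), §4 (orientations) and Ch. 5, §2, Thm. 2.10 (Euler number zero ⇒ nonvanishing
  section) — background; the transport argument replaces the obstruction theory. [HirschDT1976]
-/

open scoped Manifold ContDiff Topology RealInnerProductSpace NNReal
open Set Function Metric Module Filter

noncomputable section

namespace Literature.Topology.FourManifolds

/-- Local notation: `𝔼 n` is the model Euclidean space `EuclideanSpace ℝ (Fin n)`. -/
local notation "𝔼 " n:arg => EuclideanSpace ℝ (Fin n)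

/-- Local notation: `𝕊 n` is the unit sphere in `EuclideanSpace ℝ (Fin (n + 1))`. -/
local notation "𝕊 " n:arg => (Metric.sphere (0 : EuclideanSpace ℝ (Fin (n + 1))) 1)

/-- Local notation: `𝔽 m = ℝᵐ × ℝ²`, the fibre of the trivial bundle carrying the plane field. -/
local notation "𝔽 " m:arg => (EuclideanSpace ℝ (Fin m) × EuclideanSpace ℝ (Fin 2))

attribute [local instance] fact_finrank_euclideanSpace_succ

namespace NormalEuler

/-! ### Three families of idempotents on `ℝᵐ × ℝ²` -/

section Ops

variable {m : ℕ}

/-- The **inner idempotent** `(p, q) ↦ (Q p, 0)` attached to an operator `Q` on `ℝᵐ`. [folklore] -/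
def inOp (Q : 𝔼 m →L[ℝ] 𝔼 m) : 𝔽 m →L[ℝ] 𝔽 m :=
  (ContinuousLinearMap.inl ℝ (𝔼 m) (𝔼 2)).comp (Q.comp (ContinuousLinearMap.fst ℝ (𝔼 m) (𝔼 2)))

/-- Unfolding of `inOp`. [folklore] -/
@[simp]
theorem inOp_apply (Q : 𝔼 m →L[ℝ] 𝔼 m) (v : 𝔽 m) : inOp Q v = (Q v.1, 0) := rfl

/-- The **outer idempotent** `(p, q) ↦ (0, q)`. [folklore] -/
def outOp : 𝔽 m →L[ℝ] 𝔽 m :=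
  (ContinuousLinearMap.inr ℝ (𝔼 m) (𝔼 2)).comp (ContinuousLinearMap.snd ℝ (𝔼 m) (𝔼 2))

/-- Unfolding of `outOp`. [folklore] -/
@[simp]
theorem outOp_apply (v : 𝔽 m) : outOp v = (0, v.2) := rfl

/-- The coefficient functionals `αᵢ(p, q) = c ⟪uᵢ, p⟫ + s qᵢ` of the mixed idempotent. [folklore] -/
def mixCoeff (u : Fin 2 → 𝔼 m) (c s : ℝ) (i : Fin 2) : 𝔽 m →L[ℝ] ℝ :=
  c • (innerSL ℝ (u i)).comp (ContinuousLinearMap.fst ℝ (𝔼 m) (𝔼 2)) +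
    s • (EuclideanSpace.proj i).comp (ContinuousLinearMap.snd ℝ (𝔼 m) (𝔼 2))

/-- Unfolding of `mixCoeff`. [folklore] -/
@[simp]
theorem mixCoeff_apply (u : Fin 2 → 𝔼 m) (c s : ℝ) (i : Fin 2) (v : 𝔽 m) :
    mixCoeff u c s i v = c * ⟪u i, v.1⟫ + s * v.2 i := by
  simp [mixCoeff]

/-- The **mixed idempotent** of a pair of vectors `u₀, u₁ ∈ ℝᵐ` and an angle `(c, s)`: the
orthogonal projection of `ℝᵐ × ℝ²` onto the plane spanned by the orthonormal pair
`fᵢ = (c uᵢ, s eᵢ)` when `(u₀, u₁)` is orthonormal and `c² + s² = 1` — it rotates the plane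
`span(u₀, u₁) × 0` (`(c, s) = (1, 0)`) to the plane `0 × ℝ²` (`(c, s) = (0, 1)`). [folklore] -/
def mixOp (u : Fin 2 → 𝔼 m) (c s : ℝ) : 𝔽 m →L[ℝ] 𝔽 m :=
  ∑ i : Fin 2, (mixCoeff u c s i).smulRight ((c • u i, s • EuclideanSpace.single i (1 : ℝ)) : 𝔽 m)

/-- Unfolding of `mixOp`. [folklore] -/
theorem mixOp_apply (u : Fin 2 → 𝔼 m) (c s : ℝ) (v : 𝔽 m) :
    mixOp u c s v = ∑ i : Fin 2, (c * ⟪u i, v.1⟫ + s * v.2 i) •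
      ((c • u i, s • EuclideanSpace.single i (1 : ℝ)) : 𝔽 m) := by
  simp [mixOp]

/-- First component of `mixOp`. [folklore] -/
theorem mixOp_apply_fst (u : Fin 2 → 𝔼 m) (c s : ℝ) (v : 𝔽 m) :
    (mixOp u c s v).1 = ∑ i : Fin 2, ((c * ⟪u i, v.1⟫ + s * v.2 i) * c) • u i := by
  rw [mixOp_apply, Prod.fst_sum]
  simp [smul_smul]

/-- Second component of `mixOp`. [folklore] -/
theorem mixOp_apply_snd (u : Fin 2 → 𝔼 m) (c s : ℝ) (v : 𝔽 m) :
    (mixOp u c s v).2 = ∑ i : Fin 2, ((c * ⟪u i, v.1⟫ + s * v.2 i) * s) •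
      EuclideanSpace.single i (1 : ℝ) := by
  rw [mixOp_apply, Prod.snd_sum]
  simp [smul_smul]

/-- At the angle `(1, 0)` the mixed idempotent is `(p, q) ↦ (∑ ⟪uᵢ, p⟫ uᵢ, 0)`. [folklore] -/
theorem mixOp_one_zero (u : Fin 2 → 𝔼 m) (v : 𝔽 m) :
    mixOp u 1 0 v = (∑ i : Fin 2, ⟪u i, v.1⟫ • u i, 0) := by
  ext1
  · rw [mixOp_apply_fst]; simp
  · rw [mixOp_apply_snd]; simp

/-- At the angle `(0, 1)` the mixed idempotent is the outer idempotent. [folklore] -/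
theorem mixOp_zero_one (u : Fin 2 → 𝔼 m) (v : 𝔽 m) : mixOp u 0 1 v = outOp v := by
  ext1
  · rw [mixOp_apply_fst]; simp
  · rw [mixOp_apply_snd, outOp_apply]
    simpa using (EuclideanSpace.basisFun (Fin 2) ℝ).sum_repr v.2

/-- The coefficients of `mixOp v` are those of `v` (orthonormal `u`, `c² + s² = 1`). [folklore] -/
theorem mixCoeff_mixOp {u : Fin 2 → 𝔼 m} (hu : Orthonormal ℝ u) {c s : ℝ} (hcs : c ^ 2 + s ^ 2 = 1)
    (i : Fin 2) (v : 𝔽 m) : mixCoeff u c s i (mixOp u c s v) = mixCoeff u c s i v := by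
  have h00 : ‖u 0‖ = 1 := hu.1 0
  have h11 : ‖u 1‖ = 1 := hu.1 1
  have h01 : ⟪u 0, u 1⟫ = 0 := hu.2 (by decide)
  have h10 : ⟪u 1, u 0⟫ = 0 := hu.2 (by decide)
  rw [mixCoeff_apply, mixCoeff_apply, mixOp_apply_fst, mixOp_apply_snd]
  simp only [Fin.sum_univ_two, inner_add_right, inner_smul_right, WithLp.ofLp_add,
    WithLp.ofLp_smul, Pi.add_apply, Pi.smul_apply, smul_eq_mul]
  fin_cases i
  · simp [h00, h01]
    linear_combination (c * ⟪u 0, v.1⟫ + s * v.2 0) * hcs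
  · simp [h11, h10]
    linear_combination (c * ⟪u 1, v.1⟫ + s * v.2 1) * hcs

/-- **The mixed operator is idempotent** for an orthonormal pair and `c² + s² = 1`. [folklore] -/
theorem mixOp_mixOp {u : Fin 2 → 𝔼 m} (hu : Orthonormal ℝ u) {c s : ℝ} (hcs : c ^ 2 + s ^ 2 = 1)
    (v : 𝔽 m) : mixOp u c s (mixOp u c s v) = mixOp u c s v := by
  have h : ∀ i, mixCoeff u c s i (mixOp u c s v) = mixCoeff u c s i v :=
    fun i => mixCoeff_mixOp hu hcs i v
  simp only [mixCoeff_apply] at h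
  conv_lhs => rw [mixOp_apply]
  conv_rhs => rw [mixOp_apply]
  exact Finset.sum_congr rfl fun i _ => by rw [h i]

/-- `inOp Q` is idempotent when `Q` is. [folklore] -/
theorem inOp_inOp {Q : 𝔼 m →L[ℝ] 𝔼 m} (hQ : ∀ p, Q (Q p) = Q p) (v : 𝔽 m) :
    inOp Q (inOp Q v) = inOp Q v := by
  simp [hQ]

/-- `outOp` is idempotent. [folklore] -/
theorem outOp_outOp (v : 𝔽 m) : outOp (outOp v) = outOp v := rfl

/-- `inOp` is continuous in `Q`. [folklore] -/
theorem continuous_inOp : Continuous (inOp : (𝔼 m →L[ℝ] 𝔼 m) → 𝔽 m →L[ℝ] 𝔽 m) :=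
  continuous_const.clm_comp (continuous_id.clm_comp continuous_const)

/-- `mixOp` is a smooth function of its data `(u, c, s)` (a polynomial). [folklore] -/
theorem contDiff_mixOp :
    ContDiff ℝ ∞ fun t : (Fin 2 → 𝔼 m) × ℝ × ℝ => mixOp t.1 t.2.1 t.2.2 := by
  unfold mixOp mixCoeff
  refine ContDiff.sum fun i _ => ?_
  have hu : ContDiff ℝ ∞ fun t : (Fin 2 → 𝔼 m) × ℝ × ℝ => t.1 i :=
    (contDiff_apply ℝ (𝔼 m) i).comp contDiff_fst
  have hc : ContDiff ℝ ∞ fun t : (Fin 2 → 𝔼 m) × ℝ × ℝ => t.2.1 := contDiff_fst.comp contDiff_snd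
  have hs : ContDiff ℝ ∞ fun t : (Fin 2 → 𝔼 m) × ℝ × ℝ => t.2.2 := contDiff_snd.comp contDiff_snd
  refine ContDiff.smulRight ?_ ?_
  · exact (hc.smul (((innerSL ℝ (E := 𝔼 m)).contDiff.comp hu).clm_comp contDiff_const)).add
      (hs.smul contDiff_const)
  · exact (hc.smul hu).prodMk (hs.smul contDiff_const)

/-- `mixOp` is continuous in its data `(u, c, s)`. [folklore] -/
theorem continuous_mixOp :
    Continuous fun t : (Fin 2 → 𝔼 m) × ℝ × ℝ => mixOp t.1 t.2.1 t.2.2 :=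
  contDiff_mixOp.continuous

end Ops

/-! ### Transport of a vector through a one-parameter family of idempotents -/

section Transport

variable {F : Type*} [NormedAddCommGroup F] [NormedSpace ℝ F]

/-- **Transport step**: if `‖P' - P‖ < 1` then `P'` does not kill any nonzero vector fixed by `P`.
[folklore] -/
theorem apply_ne_zero_of_norm_sub_lt {P P' : F →L[ℝ] F} {v : F} (hv : P v = v) (hv0 : v ≠ 0)
    (h : ‖P' - P‖ < 1) : P' v ≠ 0 := by
  intro h0
  have hvpos : 0 < ‖v‖ := norm_pos_iff.2 hv0
  have h1 : ‖v‖ ≤ ‖P' - P‖ * ‖v‖ := by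
    calc ‖v‖ = ‖(P' - P) v‖ := by
          rw [show (P' - P) v = P' v - P v from rfl, h0, hv, zero_sub, norm_neg]
      _ ≤ ‖P' - P‖ * ‖v‖ := (P' - P).le_opNorm v
  have h2 : ‖P' - P‖ * ‖v‖ < 1 * ‖v‖ := by gcongr
  linarith

/-- **Discrete parallel transport**: let `H x t` (`x` in a compact metric space, `t ∈ [0, 1]`) be a
jointly continuous family of idempotents of a normed space, all fixing a nonzero vector `v₀` at
`t = 0`. Then there is a continuous nowhere-zero `σ` with `σ x` fixed by `H x 1`: transport `v₀`
along `t` in `N` steps `v ↦ H x t_{k+1} v`, where `N` is so large that consecutive idempotents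
are within operator-norm distance `1` (uniform continuity), so that no step kills a vector
(`apply_ne_zero_of_norm_sub_lt`). This replaces "a bundle over a contractible base is
trivial" in Kirby's argument. [folklore] -/
theorem exists_continuous_section {X : Type*} [PseudoMetricSpace X] [CompactSpace X]
    (H : X → unitInterval → F →L[ℝ] F) (hH : Continuous fun p : X × unitInterval => H p.1 p.2)
    (hidem : ∀ x t v, H x t (H x t v) = H x t v) {v₀ : F} (hv₀ : v₀ ≠ 0)
    (h0 : ∀ x, H x 0 v₀ = v₀) :
    ∃ σ : X → F, Continuous σ ∧ ∀ x, H x 1 (σ x) = σ x ∧ σ x ≠ 0 := by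
  -- uniform continuity: a modulus for operator-norm distance `1`
  have hU : UniformContinuous fun p : X × unitInterval => H p.1 p.2 :=
    CompactSpace.uniformContinuous_of_continuous hH
  obtain ⟨δ, hδ, hδU⟩ := Metric.uniformContinuous_iff.1 hU 1 one_pos
  obtain ⟨N, hN⟩ := exists_nat_one_div_lt hδ
  set K : ℕ := N + 1 with hK
  have hKpos : (0 : ℝ) < K := by positivity
  -- the subdivision `t_k = k / K`
  let tk : ℕ → unitInterval := fun k => Set.projIcc (0 : ℝ) 1 zero_le_one (k / K)
  have htk : ∀ k, k ≤ K → ((tk k : unitInterval) : ℝ) = k / K := by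
    intro k hk
    have hmem : (k : ℝ) / K ∈ Icc (0 : ℝ) 1 :=
      ⟨by positivity, div_le_one_of_le₀ (by exact_mod_cast hk) hKpos.le⟩
    simp only [tk, Set.projIcc_of_mem _ hmem]
  have htk0 : tk 0 = 0 := by
    simp only [tk, Nat.cast_zero, zero_div, Set.projIcc_left, Set.Icc.mk_zero]
  have htkK : tk K = 1 := by
    simp only [tk, div_self hKpos.ne', Set.projIcc_right, Set.Icc.mk_one]
  have hclose : ∀ k, k + 1 ≤ K → ∀ x, ‖H x (tk (k + 1)) - H x (tk k)‖ < 1 := by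
    intro k hk x
    have hd : dist ((x, tk (k + 1)) : X × unitInterval) (x, tk k) < δ := by
      rw [Prod.dist_eq, dist_self, max_eq_right dist_nonneg, Subtype.dist_eq, htk _ hk,
        htk _ (Nat.le_of_succ_le hk), Real.dist_eq, Nat.cast_succ, add_div, add_sub_cancel_left,
        abs_of_pos (by positivity)]
      calc (1 : ℝ) / K = 1 / ((N : ℝ) + 1) := by rw [hK, Nat.cast_succ]
        _ < δ := hN
    have := hδU hd
    rwa [dist_eq_norm] at this
  -- the transported vectors
  let σ : ℕ → X → F := fun k => Nat.rec (fun _ => v₀) (fun k σk x => H x (tk (k + 1)) (σk x)) k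
  have hσ0 : σ 0 = fun _ => v₀ := rfl
  have hσs : ∀ k, σ (k + 1) = fun x => H x (tk (k + 1)) (σ k x) := fun k => rfl
  have hHc : ∀ t, Continuous fun x => H x t := fun t =>
    hH.comp (continuous_id.prodMk continuous_const)
  have key : ∀ k, k ≤ K → Continuous (σ k) ∧ ∀ x, H x (tk k) (σ k x) = σ k x ∧ σ k x ≠ 0 := by
    intro k
    induction k with
    | zero =>
      intro _
      refine ⟨by rw [hσ0]; exact continuous_const, fun x => ⟨?_, by rw [hσ0]; exact hv₀⟩⟩
      rw [hσ0, htk0]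
      exact h0 x
    | succ k ih =>
      intro hk
      obtain ⟨hc, hfix⟩ := ih (Nat.le_of_succ_le hk)
      refine ⟨?_, fun x => ⟨?_, ?_⟩⟩
      · rw [hσs]
        exact (hHc _).clm_apply hc
      · rw [hσs]
        exact hidem x _ _
      · rw [hσs]
        exact apply_ne_zero_of_norm_sub_lt (hfix x).1 (hfix x).2 (hclose k hk x)
  obtain ⟨hc, hfix⟩ := key K le_rfl
  refine ⟨σ K, hc, fun x => ?_⟩
  have := hfix x
  rwa [htkK] at this

end Transport

/-! ### Chords of the sphere from a base point -/

section Chord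

variable {E : Type*} [NormedAddCommGroup E] [InnerProductSpace ℝ E]

/-- A chord `(1 - t) a + t y` between unit vectors with `y ≠ -a` avoids the origin (for every real
`t`). [folklore] -/
theorem chord_ne_zero {a y : E} (ha : ‖a‖ = 1) (hy : ‖y‖ = 1) (hya : y ≠ -a) (t : ℝ) :
    (1 - t) • a + t • y ≠ 0 := by
  intro h
  have h1 : (1 - t) • a = -(t • y) := eq_neg_of_add_eq_zero_left h
  have h2 : |1 - t| = |t| := by
    have := congrArg norm h1
    rwa [norm_smul, norm_neg, norm_smul, ha, hy, mul_one, mul_one, Real.norm_eq_abs,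
      Real.norm_eq_abs] at this
  have ht : t = 1 / 2 := by
    rcases abs_eq_abs.1 h2 with h3 | h3 <;> linarith
  rw [ht] at h
  have h4 : a + y = 0 := by
    have : (2 : ℝ) • ((1 - 1 / 2 : ℝ) • a + (1 / 2 : ℝ) • y) = a + y := by
      rw [smul_add, smul_smul, smul_smul]; norm_num
    rw [← this, h, smul_zero]
  exact hya (eq_neg_of_add_eq_zero_right h4)

/-- The **spherical chord path** `t ↦ ((1 - t) a + t y)/‖(1 - t) a + t y‖` from `a` to `y` on the
unit sphere. [folklore] -/
def spath (a y : E) (t : ℝ) : E :=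
  ‖(1 - t) • a + t • y‖⁻¹ • ((1 - t) • a + t • y)

/-- The spherical chord path lies on the unit sphere. [folklore] -/
theorem norm_spath {a y : E} (ha : ‖a‖ = 1) (hy : ‖y‖ = 1) (hya : y ≠ -a) (t : ℝ) :
    ‖spath a y t‖ = 1 := by
  rw [spath, norm_smul, norm_inv, norm_norm,
    inv_mul_cancel₀ (norm_ne_zero_iff.2 (chord_ne_zero ha hy hya t))]

/-- The path starts at `a`. [folklore] -/
theorem spath_zero {a y : E} (ha : ‖a‖ = 1) : spath a y 0 = a := by
  simp [spath, ha]

/-- The path ends at `y`. [folklore] -/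
theorem spath_one {a y : E} (hy : ‖y‖ = 1) : spath a y 1 = y := by
  simp [spath, hy]

end Chord

/-! ### The plane field -/

section PlaneField

variable {n : ℕ} {M : Type*} [TopologicalSpace M] [ChartedSpace (𝔼 n) M] [Nonempty M]
  [IsManifold (𝓡 n) ∞ M] {o : SmoothOrientation (𝓡 n) M} {f : M → 𝕊 (n + 2)} {ε₀ : ℝ}

variable (f ε₀) in
/-- The **normal part** `w(z) = z - ⟪z, f x⟫ f x`, `x = nearPt z`, of a point `z`: for `z` in the
tube it is the normal vector `Q_x z ∈ ν_x` with `‖w(z)‖² + ⟪z, f x⟫² = ‖z‖²`. [folklore] -/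
def wVec (z : 𝔼 (n+2+1)) : 𝔼 (n+2+1) :=
  z - ⟪z, (f (nearPt n f ε₀ z) : 𝔼 (n+2+1))⟫ • (f (nearPt n f ε₀ z) : 𝔼 (n+2+1))

variable (o f ε₀) in
/-- The **rotated normal part** `J w(z)`: the partner of `w(z)` at `x = nearPt z` (a unit vector).
[folklore] -/
def jVec (z : 𝔼 (n+2+1)) : 𝔼 (n+2+1) :=
  partner o f (nearPt n f ε₀ z) (wVec f ε₀ z)

variable (o f ε₀) in
/-- The **normal frame** `(w/‖w‖, Jw)` of a point of the tube off the core. [folklore] -/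
def nFrame (z : 𝔼 (n+2+1)) : Fin 2 → 𝔼 (n+2+1) :=
  ![‖wVec f ε₀ z‖⁻¹ • wVec f ε₀ z, jVec o f ε₀ z]

variable (f) in
/-- The collar parameter `λ(z) = 2 dist(z, f(M)) / δ - 1` (`0` on the inner boundary of the collar
`{δ/2 ≤ dist ≤ δ}`, `1` on the outer). [folklore] -/
def collarParam (δ : ℝ) (z : 𝔼 (n+2+1)) : ℝ := 2 * infDist z (img f) / δ - 1

variable (o f ε₀) in
/-- **The plane field** `P_z`, `z ∈ ℝⁿ⁺³` (used on `S^{n+2}`): the family of idempotents of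
`ℝⁿ⁺³ × ℝ²` equal to `(p, q) ↦ (Q_{x(z)} p, 0)` within `δ/2` of `f(M)` (`x(z)` the nearest point),
to `(p, q) ↦ (0, q)` beyond `δ`, and on the collar in between to the projection onto the plane
spanned by `cos θ · (w/‖w‖, 0) + sin θ · (0, e₀)` and `cos θ · (Jw, 0) + sin θ · (0, e₁)`,
`θ = (π/2) λ(z)`. This is Kirby's plane bundle `ξ ⊇ ν` over `Q = S^{n+2}` — the pull-back of the
normal bundle to its tubular neighbourhood, glued to the trivial bundle by the tautological section
`w` and the orientation `J` — realised inside the trivial bundle `Q × (ℝⁿ⁺³ × ℝ²)`.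
[cite: Kirby1989, Ch. VIII, proof of Thm. 2, pp. 44–45] -/
def planeField (δ : ℝ) (z : 𝔼 (n+2+1)) : 𝔽 (n+2+1) →L[ℝ] 𝔽 (n+2+1) :=
  if infDist z (img f) ≤ δ / 2 then inOp (norProj n f (nearPt n f ε₀ z))
  else if infDist z (img f) ≤ δ then
    mixOp (nFrame o f ε₀ z) (Real.cos (Real.pi / 2 * collarParam f δ z))
      (Real.sin (Real.pi / 2 * collarParam f δ z))
  else outOp

/-! #### Pointwise facts on the tube -/

section Pointwise

variable [CompactSpace M]
  (hf : ContMDiff (𝓡 n) (𝓡 (n + 2)) ∞ f) (hf' : ∀ x, Injective (mfderiv (𝓡 n) (𝓡 (n + 2)) f x))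
  (hε₀ : IsSphereTubeRadius n f ε₀)
include hf hf' hε₀

omit hf' in
/-- The normal part is the normal projection of `z` at its nearest point (for `z` in the tube).
[folklore] -/
theorem wVec_eq_norProj {z : 𝔼 (n+2+1)} (hz : infDist z (img f) < ε₀) :
    wVec f ε₀ z = norProj n f (nearPt n f ε₀ z) z :=
  (norProj_eq_sub_of_forall_inner hf (forall_inner_ambientDeriv_nearPt hf hε₀ hz)).symm

omit hf' in
/-- The normal part is a normal vector (for `z` in the tube). [folklore] -/
theorem norProj_wVec {z : 𝔼 (n+2+1)} (hz : infDist z (img f) < ε₀) :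
    norProj n f (nearPt n f ε₀ z) (wVec f ε₀ z) = wVec f ε₀ z := by
  rw [wVec_eq_norProj hf hε₀ hz, norProj_norProj]

omit hf' in
/-- The normal part lies in the normal space (for `z` in the tube). [folklore] -/
theorem wVec_mem_norSpace {z : 𝔼 (n+2+1)} (hz : infDist z (img f) < ε₀) :
    wVec f ε₀ z ∈ norSpace n f (nearPt n f ε₀ z) :=
  Submodule.starProjection_eq_self_iff.1 (norProj_wVec hf hε₀ hz)

omit hf hf' hε₀ [CompactSpace M] [IsManifold (𝓡 n) ∞ M] in
/-- `‖w(z)‖² + ⟪z, f x⟫² = ‖z‖²` (`x` the nearest point). [folklore] -/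
theorem norm_wVec_sq_add (z : 𝔼 (n+2+1)) :
    ‖wVec f ε₀ z‖ ^ 2 + ⟪z, (f (nearPt n f ε₀ z) : 𝔼 (n+2+1))⟫ ^ 2 = ‖z‖ ^ 2 := by
  have h1 : ‖(f (nearPt n f ε₀ z) : 𝔼 (n+2+1))‖ = 1 := norm_eq_of_mem_sphere _
  rw [wVec, norm_sub_sq_real, norm_smul, h1, mul_one, inner_smul_right, Real.norm_eq_abs, sq_abs]
  ring

omit hf' in
/-- **Off the core of the tube the normal part is nonzero**: for `z ∈ S^{n+2}` with
`0 < dist(z, f(M)) = ‖z - f x‖ < 2` (`x` the nearest point). [folklore] -/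
theorem wVec_ne_zero {z : 𝔼 (n+2+1)} (hzε : infDist z (img f) < ε₀) (hz : ‖z‖ = 1)
    (h0 : 0 < infDist z (img f)) (h2 : infDist z (img f) < 2) : wVec f ε₀ z ≠ 0 := by
  intro hw
  set x := nearPt n f ε₀ z with hx
  have h1 : ‖(f x : 𝔼 (n+2+1))‖ = 1 := norm_eq_of_mem_sphere (f x)
  have hdist : ‖z - f x‖ = infDist z (img f) := norm_sub_nearPt hf hε₀ hzε
  have hz' : z = ⟪z, (f x : 𝔼 (n+2+1))⟫ • (f x : 𝔼 (n+2+1)) := by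
    rw [← sub_eq_zero]; exact hw
  have habs : |⟪z, (f x : 𝔼 (n+2+1))⟫| = 1 := by
    have := congrArg norm hz'
    rwa [norm_smul, h1, mul_one, hz, Real.norm_eq_abs, eq_comm] at this
  rcases abs_eq (zero_le_one' ℝ) |>.1 habs with h | h
  · -- `z = f x`: distance `0`
    have : ‖z - (f x : 𝔼 (n+2+1))‖ = 0 := by
      conv_lhs => rw [hz', h, one_smul, sub_self]
      exact norm_zero
    rw [hdist] at this
    exact h0.ne' this
  · -- `z = -f x`: distance `2`
    have : ‖z - (f x : 𝔼 (n+2+1))‖ = 2 := by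
      conv_lhs => rw [hz', h, neg_one_smul, ← neg_add', norm_neg, ← two_smul ℝ]
      rw [norm_smul, h1, Real.norm_eq_abs]
      norm_num
    rw [hdist] at this
    linarith

omit hf hf' hε₀ [CompactSpace M] in
/-- The rotated normal part is a normal vector. [folklore] -/
theorem norProj_jVec (z : 𝔼 (n+2+1)) : norProj n f (nearPt n f ε₀ z) (jVec o f ε₀ z) = jVec o f ε₀ z :=
  norProj_partner _ _

omit hf hf' hε₀ [CompactSpace M] in
/-- The rotated normal part is orthogonal to the normal part. [folklore] -/
theorem inner_jVec_wVec (z : 𝔼 (n+2+1)) : ⟪jVec o f ε₀ z, wVec f ε₀ z⟫ = 0 :=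
  inner_partner_self _ _

/-- Off the core of the tube the rotated normal part is a unit vector. [folklore] -/
theorem norm_jVec {z : 𝔼 (n+2+1)} (hz : infDist z (img f) < ε₀) (hw : wVec f ε₀ z ≠ 0) :
    ‖jVec o f ε₀ z‖ = 1 :=
  norm_partner hf (hf' _) (wVec_mem_norSpace hf hε₀ hz) hw

/-- **The normal frame is orthonormal** off the core of the tube. [folklore] -/
theorem orthonormal_nFrame {z : 𝔼 (n+2+1)} (hz : infDist z (img f) < ε₀) (hw : wVec f ε₀ z ≠ 0) :
    Orthonormal ℝ (nFrame o f ε₀ z) := by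
  have hj := norm_jVec (o := o) hf hf' hε₀ hz hw
  have hwn : ‖wVec f ε₀ z‖ ≠ 0 := norm_ne_zero_iff.2 hw
  have e0 : nFrame o f ε₀ z 0 = ‖wVec f ε₀ z‖⁻¹ • wVec f ε₀ z := rfl
  have e1 : nFrame o f ε₀ z 1 = jVec o f ε₀ z := rfl
  refine ⟨fun i => ?_, fun i j hij => ?_⟩
  · fin_cases i
    · change ‖nFrame o f ε₀ z 0‖ = 1
      rw [e0, norm_smul, norm_inv, norm_norm, inv_mul_cancel₀ hwn]
    · change ‖nFrame o f ε₀ z 1‖ = 1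
      rw [e1, hj]
  · fin_cases i <;> fin_cases j
    · exact absurd rfl hij
    · change ⟪nFrame o f ε₀ z 0, nFrame o f ε₀ z 1⟫ = 0
      rw [e0, e1, inner_smul_left, real_inner_comm (jVec o f ε₀ z) (wVec f ε₀ z),
        inner_jVec_wVec, mul_zero]
    · change ⟪nFrame o f ε₀ z 1, nFrame o f ε₀ z 0⟫ = 0
      rw [e0, e1, inner_smul_right, inner_jVec_wVec, mul_zero]
    · exact absurd rfl hij

omit hf' in
/-- The normal frame consists of normal vectors (for `z` in the tube). [folklore] -/
theorem norProj_nFrame {z : 𝔼 (n+2+1)} (hz : infDist z (img f) < ε₀) (i : Fin 2) :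
    norProj n f (nearPt n f ε₀ z) (nFrame o f ε₀ z i) = nFrame o f ε₀ z i := by
  fin_cases i
  · simp [nFrame, map_smul, norProj_wVec hf hε₀ hz]
  · simp [nFrame, norProj_jVec]

/-- **Matching on the inner boundary of the collar**: off the core, `mixOp (nFrame z) 1 0` is the
inner idempotent of the normal projection at the nearest point (an orthonormal pair of normal
vectors spans the normal plane). [folklore] -/
theorem mixOp_nFrame_one_zero {z : 𝔼 (n+2+1)} (hz : infDist z (img f) < ε₀) (hw : wVec f ε₀ z ≠ 0) :
    mixOp (nFrame o f ε₀ z) 1 0 = inOp (norProj n f (nearPt n f ε₀ z)) := by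
  refine ContinuousLinearMap.ext fun v => ?_
  rw [mixOp_one_zero, inOp_apply, norProj_eq_sum_inner_smul hf (hf' _) rfl
    (orthonormal_nFrame hf hf' hε₀ hz hw) (norProj_nFrame hf hε₀ hz)]

/-- **The plane field consists of idempotents** (at points of `S^{n+2}`, for `0 < δ < ε₀`, `δ < 2`).
[folklore] -/
theorem planeField_planeField {δ : ℝ} (hδ : 0 < δ) (hδε : δ < ε₀) (hδ2 : δ < 2) {z : 𝔼 (n+2+1)}
    (hz : ‖z‖ = 1) (v : 𝔽 (n+2+1)) :
    planeField o f ε₀ δ z (planeField o f ε₀ δ z v) = planeField o f ε₀ δ z v := by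
  unfold planeField
  split_ifs with h1 h2
  · exact inOp_inOp (norProj_norProj _) v
  · have hzε : infDist z (img f) < ε₀ := h2.trans_lt hδε
    have hw : wVec f ε₀ z ≠ 0 :=
      wVec_ne_zero hf hε₀ hzε hz (by push Not at h1; linarith) (h2.trans_lt hδ2)
    exact mixOp_mixOp (orthonormal_nFrame hf hf' hε₀ hzε hw) (Real.cos_sq_add_sin_sq _) v
  · rfl

omit hf hf' hε₀ [CompactSpace M] in
/-- Far from the image the plane field is the outer idempotent. [folklore] -/
theorem planeField_eq_outOp {δ : ℝ} (hδ : 0 < δ) {z : 𝔼 (n+2+1)} (hz : δ < infDist z (img f)) :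
    planeField o f ε₀ δ z = outOp := by
  unfold planeField
  rw [if_neg (by linarith), if_neg (by linarith)]

omit hf hf' [CompactSpace M] in
/-- **On the image the plane field is the normal projection**: `P_{f x} = (p, q) ↦ (Q_x p, 0)`
(`x` is the nearest point of `f x`). [folklore] -/
theorem planeField_coe {δ : ℝ} (hδ : 0 < δ) (x : M) :
    planeField o f ε₀ δ (f x) = inOp (norProj n f x) := by
  unfold planeField
  rw [if_pos (by rw [infDist_coe_img]; linarith), nearPt_coe hε₀]

end Pointwise

/-! #### Continuity of the plane field on `S^{n+2}` -/

section Continuity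

variable [CompactSpace M]
  (hf : ContMDiff (𝓡 n) (𝓡 (n + 2)) ∞ f) (hf' : ∀ x, Injective (mfderiv (𝓡 n) (𝓡 (n + 2)) f x))
  (hε₀ : IsSphereTubeRadius n f ε₀)
include hf hf' hε₀

omit hf' in
/-- The normal part is continuous on the tube. [folklore] -/
theorem continuousOn_wVec : ContinuousOn (wVec f ε₀) {z | infDist z (img f) < ε₀} := by
  have hπ := continuousOn_nearPt hf hε₀
  have hfc : Continuous fun x : M => (f x : 𝔼 (n+2+1)) := (contMDiff_sphCoe hf).continuous
  have hfx : ContinuousOn (fun z => (f (nearPt n f ε₀ z) : 𝔼 (n+2+1))) {z | infDist z (img f) < ε₀} :=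
    hfc.comp_continuousOn hπ
  have h2 : ContinuousOn (fun z => ⟪z, (f (nearPt n f ε₀ z) : 𝔼 (n+2+1))⟫ •
      (f (nearPt n f ε₀ z) : 𝔼 (n+2+1))) {z | infDist z (img f) < ε₀} :=
    (continuousOn_id.inner hfx).fun_smul hfx
  exact continuousOn_id.sub h2

/-- The rotated normal part is continuous on the punctured part of the tube in `S^{n+2}`.
[folklore] -/
theorem continuousOn_jVec {δ : ℝ} (hδε : δ < ε₀) (hδ2 : δ < 2) :
    ContinuousOn (jVec o f ε₀) {z | infDist z (img f) ≤ δ ∧ 0 < infDist z (img f) ∧ ‖z‖ = 1} := by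
  have hsub : {z : 𝔼 (n+2+1) | infDist z (img f) ≤ δ ∧ 0 < infDist z (img f) ∧ ‖z‖ = 1} ⊆
      {z | infDist z (img f) < ε₀} := fun z hz => hz.1.trans_lt hδε
  have hπ := (continuousOn_nearPt hf hε₀).mono hsub
  have hw := (continuousOn_wVec hf hε₀).mono hsub
  have hdata : ContinuousOn (fun z => (nearPt n f ε₀ z, wVec f ε₀ z))
      {z | infDist z (img f) ≤ δ ∧ 0 < infDist z (img f) ∧ ‖z‖ = 1} := hπ.prodMk hw
  have hmaps : MapsTo (fun z => (nearPt n f ε₀ z, wVec f ε₀ z))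
      {z | infDist z (img f) ≤ δ ∧ 0 < infDist z (img f) ∧ ‖z‖ = 1}
      {p : M × 𝔼 (n+2+1) | p.2 ∈ norSpace n f p.1 ∧ p.2 ≠ 0} := fun z hz =>
    ⟨wVec_mem_norSpace hf hε₀ (hsub hz),
      wVec_ne_zero hf hε₀ (hsub hz) hz.2.2 hz.2.1 (hz.1.trans_lt hδ2)⟩
  -- (`congr` rather than `exact`: unfolding `partner` by unification is slow)
  refine ((continuousOn_partner (o := o) hf hf').comp hdata hmaps).congr fun z _ => ?_
  simp only [Function.comp_apply, jVec]

/-- The normal frame is continuous on the punctured part of the tube in `S^{n+2}`. [folklore] -/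
theorem continuousOn_nFrame {δ : ℝ} (hδε : δ < ε₀) (hδ2 : δ < 2) :
    ContinuousOn (nFrame o f ε₀) {z | infDist z (img f) ≤ δ ∧ 0 < infDist z (img f) ∧ ‖z‖ = 1} := by
  have hsub : {z : 𝔼 (n+2+1) | infDist z (img f) ≤ δ ∧ 0 < infDist z (img f) ∧ ‖z‖ = 1} ⊆
      {z | infDist z (img f) < ε₀} := fun z hz => hz.1.trans_lt hδε
  have hw := (continuousOn_wVec hf hε₀).mono hsub
  have hj := continuousOn_jVec hf hf' hε₀ hδε hδ2 (o := o)
  have hw0 : ∀ z ∈ {z : 𝔼 (n+2+1) | infDist z (img f) ≤ δ ∧ 0 < infDist z (img f) ∧ ‖z‖ = 1},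
      wVec f ε₀ z ≠ 0 := fun z hz => wVec_ne_zero hf hε₀ (hsub hz) hz.2.2 hz.2.1 (hz.1.trans_lt hδ2)
  have h0 : ContinuousOn (fun z => ‖wVec f ε₀ z‖⁻¹ • wVec f ε₀ z) _ :=
    (hw.norm.inv₀ fun z hz => norm_ne_zero_iff.2 (hw0 z hz)).smul hw
  rw [continuousOn_pi]
  intro i
  fin_cases i
  · exact h0
  · exact hj

omit hf hf' hε₀ [CompactSpace M] [TopologicalSpace M] [ChartedSpace (𝔼 n) M] [Nonempty M]
  [IsManifold (𝓡 n) ∞ M] in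
/-- The collar parameter is continuous. [folklore] -/
theorem continuous_collarParam (δ : ℝ) : Continuous (collarParam f δ) :=
  ((continuous_const.mul (continuous_infDist_pt _)).div_const δ).sub continuous_const

/-- **The plane field is continuous on `S^{n+2}`** (for `0 < δ < ε₀`, `δ < 2`): the three pieces are
continuous on their closed domains and agree on the interfaces (`mixOp_nFrame_one_zero`,
`mixOp_zero_one`). [folklore] -/
theorem continuousOn_planeField {δ : ℝ} (hδ : 0 < δ) (hδε : δ < ε₀) (hδ2 : δ < 2) :
    ContinuousOn (planeField o f ε₀ δ) (sphere (0 : 𝔼 (n+2+1)) 1) := by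
  have hρ : Continuous fun z : 𝔼 (n+2+1) => infDist z (img f) := continuous_infDist_pt _
  have hQ : Continuous fun x : M => norProj n f x := continuous_norProj hf hf'
  have hπ := continuousOn_nearPt hf hε₀
  -- piece 1 on `{dist ≤ δ/2}`
  have h1 : ContinuousOn (fun z => inOp (norProj n f (nearPt n f ε₀ z)))
      (sphere (0 : 𝔼 (n+2+1)) 1 ∩ closure {z | infDist z (img f) ≤ δ / 2}) := by
    refine continuous_inOp.comp_continuousOn (hQ.comp_continuousOn (hπ.mono ?_))
    rw [(isClosed_le hρ continuous_const).closure_eq]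
    rintro z ⟨-, hz⟩
    exact lt_of_le_of_lt (show infDist z (img f) ≤ δ / 2 from hz) (by linarith)
  -- piece 2 on `{δ/2 ≤ dist ≤ δ} ∩ S`
  have h2 : ContinuousOn (fun z => mixOp (nFrame o f ε₀ z) (Real.cos (Real.pi / 2 * collarParam f δ z))
      (Real.sin (Real.pi / 2 * collarParam f δ z)))
      {z | infDist z (img f) ≤ δ ∧ 0 < infDist z (img f) ∧ ‖z‖ = 1} := by
    have hc := continuous_collarParam (f := f) δ
    have hcs : Continuous fun z => (Real.cos (Real.pi / 2 * collarParam f δ z),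
        Real.sin (Real.pi / 2 * collarParam f δ z)) :=
      (Real.continuous_cos.comp (continuous_const.mul hc)).prodMk
        (Real.continuous_sin.comp (continuous_const.mul hc))
    have := continuous_mixOp.comp_continuousOn
      ((continuousOn_nFrame hf hf' hε₀ hδε hδ2 (o := o)).prodMk hcs.continuousOn)
    exact this
  -- pieces 2 and 3 on `{δ/2 ≤ dist} ∩ S`
  have h23 : ContinuousOn (fun z => if infDist z (img f) ≤ δ then
      mixOp (nFrame o f ε₀ z) (Real.cos (Real.pi / 2 * collarParam f δ z))
        (Real.sin (Real.pi / 2 * collarParam f δ z)) else outOp)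
      (sphere (0 : 𝔼 (n+2+1)) 1 ∩ closure {z | ¬infDist z (img f) ≤ δ / 2}) := by
    refine ContinuousOn.if ?_ ?_ continuousOn_const
    · -- interface `dist = δ`
      rintro z ⟨⟨-, -⟩, hz⟩
      have hzδ : infDist z (img f) = δ := frontier_le_subset_eq hρ continuous_const hz
      have hlam : collarParam f δ z = 1 := by
        rw [collarParam, hzδ]; field_simp; ring
      rw [hlam, mul_one, Real.cos_pi_div_two, Real.sin_pi_div_two]
      exact ContinuousLinearMap.ext (mixOp_zero_one _)
    · refine h2.mono ?_
      rintro z ⟨⟨hz1, hz2⟩, hz3⟩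
      rw [(isClosed_le hρ continuous_const).closure_eq] at hz3
      refine ⟨hz3, ?_, by simpa using hz1⟩
      have : δ / 2 ≤ infDist z (img f) := by
        have := closure_lt_subset_le continuous_const hρ (by simpa [not_le] using hz2)
        exact this
      linarith
  -- assemble
  unfold planeField
  refine ContinuousOn.if ?_ h1 h23
  -- interface `dist = δ/2`
  rintro z ⟨hz, hfr⟩
  have hzδ : infDist z (img f) = δ / 2 := frontier_le_subset_eq hρ continuous_const hfr
  have hz1 : ‖z‖ = 1 := by simpa using hz
  rw [if_pos (by linarith)]
  have hlam : collarParam f δ z = 0 := by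
    rw [collarParam, hzδ]; field_simp; ring
  rw [hlam, mul_zero, Real.cos_zero, Real.sin_zero]
  have hzε : infDist z (img f) < ε₀ := by linarith
  have hw : wVec f ε₀ z ≠ 0 := wVec_ne_zero hf hε₀ hzε hz1 (by linarith) (by linarith)
  exact (mixOp_nFrame_one_zero hf hf' hε₀ hzε hw).symm

end Continuity

end PlaneField

/-! ### The continuous nowhere-zero normal field -/

section Existence

variable {n : ℕ} {M : Type*} [TopologicalSpace M] [ChartedSpace (𝔼 n) M] [Nonempty M]
  [IsManifold (𝓡 n) ∞ M] [CompactSpace M]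
  {o : SmoothOrientation (𝓡 n) M} {f : M → 𝕊 (n + 2)} {ε₀ : ℝ}

variable (o f ε₀) in
/-- The plane field read along the spherical chord from `a` to `f x`: the one-parameter family of
idempotents through which normal vectors are transported. [folklore] -/
def chordField (δ : ℝ) (a : 𝔼 (n+2+1)) (x : M) (t : unitInterval) : 𝔽 (n+2+1) →L[ℝ] 𝔽 (n+2+1) :=
  planeField o f ε₀ δ (spath a (f x : 𝔼 (n+2+1)) t)

omit [Nonempty M] [CompactSpace M] [ChartedSpace (𝔼 n) M] [IsManifold (𝓡 n) ∞ M] in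
/-- The spherical chords from `a` to the points `f x` depend continuously on `(x, t)` (when no
`f x` is antipodal to `a`). [folklore] -/
theorem continuous_spath_coe (hfc : Continuous fun x : M => (f x : 𝔼 (n+2+1))) {a : 𝔼 (n+2+1)}
    (ha1 : ‖a‖ = 1) (hya : ∀ x : M, (f x : 𝔼 (n+2+1)) ≠ -a) :
    Continuous fun p : M × unitInterval => spath a (f p.1 : 𝔼 (n+2+1)) (p.2 : ℝ) := by
  have hc : Continuous fun p : M × unitInterval =>
      (1 - (p.2 : ℝ)) • a + (p.2 : ℝ) • (f p.1 : 𝔼 (n+2+1)) :=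
    ((continuous_const.sub (continuous_subtype_val.comp continuous_snd)).smul
      continuous_const).add
      ((continuous_subtype_val.comp continuous_snd).smul (hfc.comp continuous_fst))
  have hn : Continuous fun p : M × unitInterval =>
      ‖(1 - (p.2 : ℝ)) • a + (p.2 : ℝ) • (f p.1 : 𝔼 (n+2+1))‖⁻¹ :=
    hc.norm.inv₀ fun p => norm_ne_zero_iff.2
      (chord_ne_zero ha1 (norm_eq_of_mem_sphere (f p.1)) (hya p.1) _)
  exact hn.smul hc

variable (hf : ContMDiff (𝓡 n) (𝓡 (n + 2)) ∞ f) (hf' : ∀ x, Injective (mfderiv (𝓡 n) (𝓡 (n + 2)) f x))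
  (hε₀ : IsSphereTubeRadius n f ε₀)
include hf hf' hε₀

/-- **The chord field is jointly continuous** in `(x, t)`. [folklore] -/
theorem continuous_chordField {δ : ℝ} (hδ : 0 < δ) (hδε : δ < ε₀) (hδ2 : δ < 2)
    {a : 𝔼 (n+2+1)} (ha1 : ‖a‖ = 1) (hya : ∀ x : M, (f x : 𝔼 (n+2+1)) ≠ -a) :
    Continuous fun p : M × unitInterval => chordField o f ε₀ δ a p.1 p.2 := by
  have hγ := continuous_spath_coe (contMDiff_sphCoe hf).continuous ha1 hya
  have hP := continuousOn_planeField hf hf' hε₀ hδ hδε hδ2 (o := o)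
  have hmem : ∀ p : M × unitInterval, spath a (f p.1 : 𝔼 (n+2+1)) (p.2 : ℝ) ∈
      sphere (0 : 𝔼 (n+2+1)) 1 :=
    fun p => mem_sphere_zero_iff_norm.2
      (norm_spath ha1 (norm_eq_of_mem_sphere (f p.1)) (hya p.1) _)
  have := hP.comp_continuous hγ hmem
  exact this

/-- The chord field consists of idempotents. [folklore] -/
theorem chordField_chordField {δ : ℝ} (hδ : 0 < δ) (hδε : δ < ε₀) (hδ2 : δ < 2)
    {a : 𝔼 (n+2+1)} (ha1 : ‖a‖ = 1) (hya : ∀ x : M, (f x : 𝔼 (n+2+1)) ≠ -a) (x : M) (t : unitInterval)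
    (v : 𝔽 (n+2+1)) :
    chordField o f ε₀ δ a x t (chordField o f ε₀ δ a x t v) = chordField o f ε₀ δ a x t v :=
  planeField_planeField hf hf' hε₀ hδ hδε hδ2
    (norm_spath ha1 (norm_eq_of_mem_sphere (f x)) (hya x) _) v

omit hf hf' hε₀ [CompactSpace M] in
/-- At `t = 0` the chord field is `P_a`, the outer idempotent when `a` is far from the image.
[folklore] -/
theorem chordField_zero {δ : ℝ} (hδ : 0 < δ) {a : 𝔼 (n+2+1)} (ha1 : ‖a‖ = 1)
    (hδa : δ < infDist a (img f)) (x : M) : chordField o f ε₀ δ a x 0 = outOp := by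
  rw [chordField, Set.Icc.coe_zero, spath_zero ha1, planeField_eq_outOp hδ hδa]

omit hf hf' [CompactSpace M] in
/-- At `t = 1` the chord field is `P_{f x} = inOp Q_x`. [folklore] -/
theorem chordField_one {δ : ℝ} (hδ : 0 < δ) (a : 𝔼 (n+2+1)) (x : M) :
    chordField o f ε₀ δ a x 1 = inOp (norProj n f x) := by
  rw [chordField, Set.Icc.coe_one, spath_one (norm_eq_of_mem_sphere (f x)), planeField_coe hε₀ hδ]

end Existence

end NormalEuler

/-! ### Main theorems -/

section Main

open NormalEuler

variable {n : ℕ} {M : Type*} [TopologicalSpace M] [ChartedSpace (𝔼 n) M]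
  [IsManifold (𝓡 n) ∞ M] [CompactSpace M] [T2Space M] {f : M → 𝕊 (n + 2)}
  (o : SmoothOrientation (𝓡 n) M)
  (hf : ContMDiff (𝓡 n) (𝓡 (n + 2)) ∞ f) (hf' : ∀ x, Injective (mfderiv (𝓡 n) (𝓡 (n + 2)) f x))
  (hinj : Injective f)
include o hf hf' hinj

/-- **A continuous nowhere-zero normal field along a smooth embedding `f : M → 𝕊ⁿ⁺²` of a compact
oriented `n`-manifold**: a continuous `s₀ : M → ℝⁿ⁺³` with `Q_x (s₀ x) = s₀ x ≠ 0`. Proof: choose a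
base point `a ∈ S^{n+2}` with `±a ∉ f(M)` and a radius `δ` below a tube radius, `1`, and
`dist(a, f(M))`; transport the vector `(0, e₀)`, fixed by `P_a = outOp`, through the plane field
along the spherical chords from `a` to `f x` (`exists_continuous_section`); the result is fixed by
`P_{f x} = inOp Q_x`, i.e. it is `(s₀ x, 0)` with `s₀ x ∈ ν_x ∖ 0`.
[cite: Kirby1989, Ch. VIII, proof of Thm. 2, pp. 44–45] -/
theorem exists_continuous_normal_of_embedding :
    ∃ s₀ : M → 𝔼 (n+2+1), Continuous s₀ ∧ ∀ x : M, norProj n f x (s₀ x) = s₀ x ∧ s₀ x ≠ 0 := by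
  rcases isEmpty_or_nonempty M with hM | hM
  · exact ⟨fun _ => 0, continuous_const, fun x => (IsEmpty.false x).elim⟩
  haveI := Manifold.metrizableSpace (𝓡 n) M
  letI : MetricSpace M := TopologicalSpace.metrizableSpaceMetric M
  haveI := ChartedSpace.secondCountable_of_sigmaCompact (𝔼 n) M
  have hfc : Continuous fun x : M => (f x : 𝔼 (n+2+1)) := (contMDiff_sphCoe hf).continuous
  -- base point `a` with `±a ∉ f(M)`
  obtain ⟨a, ha, ha'⟩ := exists_notMem_range_neg_notMem_range (f := f) (by omega : n < n + 2)
    (hf.of_le (by exact_mod_cast le_top))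
  have ha1 : ‖(a : 𝔼 (n+2+1))‖ = 1 := norm_eq_of_mem_sphere a
  have hya : ∀ x : M, (f x : 𝔼 (n+2+1)) ≠ -(a : 𝔼 (n+2+1)) := by
    intro x hx
    exact ha' ⟨x, Subtype.ext (by rw [hx]; rfl)⟩
  have hdist : 0 < infDist (a : 𝔼 (n+2+1)) (img f) := by
    have hcl : IsClosed (img f) := (isCompact_img hf.continuous).isClosed
    refine (hcl.notMem_iff_infDist_pos ⟨_, ⟨Classical.arbitrary M, rfl⟩⟩).1 ?_
    rintro ⟨x, hx⟩
    exact ha ⟨x, Subtype.ext hx⟩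
  -- the radii
  obtain ⟨ε₀, hε₀⟩ := exists_isSphereTubeRadius hf hf' hinj
  set δ : ℝ := min (ε₀ / 2) (min 1 (infDist (a : 𝔼 (n+2+1)) (img f) / 2)) with hδ
  have hδpos : 0 < δ := by
    simp only [hδ, lt_min_iff]; exact ⟨by linarith [hε₀.pos], one_pos, by linarith⟩
  have hδε : δ < ε₀ := by
    have : δ ≤ ε₀ / 2 := min_le_left _ _
    linarith [hε₀.pos]
  have hδ2 : δ < 2 := by
    have : δ ≤ 1 := (min_le_right _ _).trans (min_le_left _ _)
    linarith
  have hδa : δ < infDist (a : 𝔼 (n+2+1)) (img f) := by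
    have : δ ≤ infDist (a : 𝔼 (n+2+1)) (img f) / 2 := (min_le_right _ _).trans (min_le_right _ _)
    linarith
  -- the family of idempotents along the chords, and the initial vector `(0, e₀)`
  have hH := continuous_chordField hf hf' hε₀ hδpos hδε hδ2 ha1 hya (o := o)
  set v₀ : 𝔽 (n+2+1) := ((0 : 𝔼 (n+2+1)), EuclideanSpace.single (0 : Fin 2) (1 : ℝ)) with hv₀
  have hv₀0 : v₀ ≠ 0 := by
    intro h
    have := congrArg (fun v : 𝔽 (n+2+1) => v.2 0) h
    simp [hv₀] at this
  have h0 : ∀ x, chordField o f ε₀ δ a x 0 v₀ = v₀ := by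
    intro x
    rw [chordField_zero hδpos ha1 hδa]
    rfl
  obtain ⟨σ, hσc, hσ⟩ := exists_continuous_section (chordField o f ε₀ δ a) hH
    (chordField_chordField hf hf' hε₀ hδpos hδε hδ2 ha1 hya) hv₀0 h0
  -- read off the normal field at `t = 1`
  refine ⟨fun x => (σ x).1, continuous_fst.comp hσc, fun x => ?_⟩
  obtain ⟨hfix, hne⟩ := hσ x
  rw [chordField_one hε₀ hδpos] at hfix
  have hfst : norProj n f x (σ x).1 = (σ x).1 := congrArg Prod.fst hfix
  have hsnd : (σ x).2 = 0 := by
    have := congrArg Prod.snd hfix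
    simpa using this.symm
  refine ⟨hfst, fun h => hne ?_⟩
  exact Prod.ext h hsnd

omit o hinj in
/-- **Smoothing a continuous normal field**: a continuous nowhere-zero `s₀` with `Q s₀ = s₀` yields a
`C^∞` nowhere-zero normal field, by smooth approximation (Mathlib's
`Continuous.exists_contMDiff_approx`) and re-projection onto the normal planes by the smooth field
`Q`. [cite: Kirby1989, Ch. VIII, Thm. 2] -/
theorem exists_contMDiff_normal_of_continuous {s₀ : M → 𝔼 (n+2+1)} (hs₀c : Continuous s₀)
    (hs₀ : ∀ x : M, norProj n f x (s₀ x) = s₀ x ∧ s₀ x ≠ 0) :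
    ∃ s : M → 𝔼 (n+2+1), ContMDiff (𝓡 n) 𝓘(ℝ, 𝔼 (n+2+1)) ∞ s ∧
      ∀ x : M, norProj n f x (s x) = s x ∧ s x ≠ 0 := by
  rcases isEmpty_or_nonempty M with hM | hM
  · exact ⟨fun _ => 0, contMDiff_const, fun x => (IsEmpty.false x).elim⟩
  -- a positive lower bound for `‖s₀‖`
  obtain ⟨x₀, -, hx₀⟩ := isCompact_univ.exists_isMinOn univ_nonempty hs₀c.norm.continuousOn
  set m : ℝ := ‖s₀ x₀‖ with hm
  have hmpos : 0 < m := norm_pos_iff.2 (hs₀ x₀).2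
  have hmle : ∀ x, m ≤ ‖s₀ x‖ := fun x => hx₀ (mem_univ x)
  -- smooth approximation within `m / 2`
  obtain ⟨g, hg, -⟩ := hs₀c.exists_contMDiff_approx (𝓡 n) (⊤ : ℕ∞) (ε := fun _ => m / 2)
    continuous_const (fun _ => half_pos hmpos)
  refine ⟨fun x : M => norProj n f x (g x), (contMDiff_norProj hf hf').clm_apply g.contMDiff,
    fun x => ⟨norProj_norProj x _, fun h0 => ?_⟩⟩
  -- `‖Q g - s₀‖ ≤ ‖g - s₀‖ < m/2` contradicts `Q g = 0`, `‖s₀‖ ≥ m`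
  have h1 : ‖norProj n f x (g x) - s₀ x‖ < m / 2 := by
    have : norProj n f x (g x) - s₀ x = norProj n f x (g x - s₀ x) := by
      rw [map_sub, (hs₀ x).1]
    rw [this]
    exact (norm_norProj_le x _).trans_lt (by rw [← dist_eq_norm]; exact hg x)
  have h0' : norProj n f x (g x) = 0 := h0
  rw [h0', zero_sub, norm_neg] at h1
  linarith [hmle x]

/-- **A smooth nowhere-zero normal field along a smooth embedding `f : M → 𝕊ⁿ⁺²`** of a compact
oriented `n`-manifold. [cite: Kirby1989, Ch. VIII, Thm. 2] -/
theorem exists_contMDiff_normal_of_embedding :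
    ∃ s : M → 𝔼 (n+2+1), ContMDiff (𝓡 n) 𝓘(ℝ, 𝔼 (n+2+1)) ∞ s ∧
      ∀ x : M, norProj n f x (s x) = s x ∧ s x ≠ 0 := by
  obtain ⟨s₀, hs₀c, hs₀⟩ := exists_continuous_normal_of_embedding o hf hf' hinj
  exact exists_contMDiff_normal_of_continuous hf hf' hs₀c hs₀

/-- **Kirby's Theorem VIII.2 for `Q = S^{n+2}`, the "non-zero cross-section"**: a smooth embedding
`f : M → 𝕊ⁿ⁺²` of a compact oriented `n`-manifold admits a normal `1`-framing — a `C^∞` vector field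
tangent to `𝕊ⁿ⁺²` and nowhere tangent to `f` (the Euler class of the normal bundle vanishes).
[cite: Kirby1989, Ch. VIII Thm. 2] -/
theorem exists_isNormalFraming_one_of_embedding :
    ∃ s : M → 𝔼 (n+2+1), IsNormalFraming (𝓡 n) f (fun _ : Fin 1 => s) := by
  obtain ⟨s, hs, hsn⟩ := exists_contMDiff_normal_of_embedding o hf hf' hinj
  refine ⟨s, ⟨fun _ => hs, fun _ x => ?_, fun x v a h => ?_⟩⟩
  · rw [← (hsn x).1]
    exact inner_norProj_coe x _
  · simp only [Finset.univ_unique, Fin.default_eq_zero, Fin.isValue, Finset.sum_singleton] at h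
    have h2 := congrArg (norProj n f x) h
    rw [map_add, map_smul, norProj_ambientDeriv x, (hsn x).1, zero_add, map_zero,
      smul_eq_zero] at h2
    funext i
    rw [Subsingleton.elim i 0]
    exact h2.resolve_right (hsn x).2

/-! #### The second field: the partner, smoothed -/

omit hinj in
/-- **Completing a smooth nowhere-zero normal field to a normal `2`-framing** ("Since the normal
bundle is oriented, it is enough to find a non-zero cross-section"): the partner field `J s`
(`CodimTwoNormalPartner.lean`) is a continuous unit normal field orthogonal to `s`; smoothing it and
re-projecting onto `ν ∩ sᗮ` gives a smooth `t` with `(s, t)` a normal framing.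
[cite: Kirby1989, Ch. VIII, proof of Thm. 2, p. 44] -/
theorem exists_isNormalFraming_two_of_normal {s : M → 𝔼 (n+2+1)}
    (hs : ContMDiff (𝓡 n) 𝓘(ℝ, 𝔼 (n+2+1)) ∞ s) (hsn : ∀ x : M, norProj n f x (s x) = s x ∧ s x ≠ 0) :
    ∃ t : M → 𝔼 (n+2+1), IsNormalFraming (𝓡 n) f ![s, t] := by
  rcases isEmpty_or_nonempty M with hM | hM
  · refine ⟨fun _ => 0, ⟨?_, fun _ x => (IsEmpty.false x).elim, fun x => (IsEmpty.false x).elim⟩⟩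
    intro i
    fin_cases i
    · exact hs
    · exact contMDiff_const
  have hsmem : ∀ x, s x ∈ norSpace n f x := fun x => Submodule.starProjection_eq_self_iff.1 (hsn x).1
  -- the continuous unit partner field
  set t₀ : M → 𝔼 (n+2+1) := fun x => partner o f x (s x) with ht₀
  have ht₀c : Continuous t₀ := by
    have h := continuousOn_partner (o := o) hf hf'
    have hdata : Continuous fun x : M => (x, s x) := continuous_id.prodMk hs.continuous
    -- (`congr` rather than `exact`: unfolding `partner` by unification is slow)
    refine (h.comp_continuous hdata fun x => ⟨hsmem x, (hsn x).2⟩).congr fun x => ?_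
    simp only [Function.comp_apply, ht₀]
  have ht₀n : ∀ x, ‖t₀ x‖ = 1 := fun x => norm_partner hf (hf' x) (hsmem x) (hsn x).2
  have ht₀Q : ∀ x, norProj n f x (t₀ x) = t₀ x := fun x => norProj_partner x (s x)
  have ht₀s : ∀ x, ⟪t₀ x, s x⟫ = 0 := fun x => inner_partner_self x (s x)
  -- the unit field `ŝ` and the projection `P_x = Q_x - ⟪ŝ, ·⟫ ŝ` onto `ν_x ∩ (s x)ᗮ`
  set u : M → 𝔼 (n+2+1) := fun x => ‖s x‖⁻¹ • s x with hu
  have hun : ∀ x, ‖u x‖ = 1 := fun x => by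
    rw [hu, norm_smul, norm_inv, norm_norm, inv_mul_cancel₀ (norm_ne_zero_iff.2 (hsn x).2)]
  have hnorm : ContMDiff (𝓡 n) 𝓘(ℝ, ℝ) ∞ fun x => ‖s x‖ := fun x =>
    ((contDiffAt_norm ℝ (hsn x).2).of_le le_top).contMDiffAt.comp x (hs x)
  have huc : ContMDiff (𝓡 n) 𝓘(ℝ, 𝔼 (n+2+1)) ∞ u :=
    (hnorm.inv₀ fun x => norm_ne_zero_iff.2 (hsn x).2).smul hs
  have huQ : ∀ x, norProj n f x (u x) = u x := fun x => by
    rw [hu, map_smul, (hsn x).1]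
  have hut₀ : ∀ x, ⟪u x, t₀ x⟫ = 0 := fun x => by
    rw [hu, inner_smul_left, real_inner_comm, ht₀s]; simp
  set P : M → 𝔼 (n+2+1) →L[ℝ] 𝔼 (n+2+1) := fun x =>
    norProj n f x - (innerSL ℝ (u x)).smulRight (u x) with hP
  have hPapply : ∀ x z, P x z = norProj n f x z - ⟪u x, z⟫ • u x := fun x z => rfl
  have hPc : ContMDiff (𝓡 n) 𝓘(ℝ, 𝔼 (n+2+1) →L[ℝ] 𝔼 (n+2+1)) ∞ P := by
    have h4 : ContMDiff (𝓡 n) 𝓘(ℝ, 𝔼 (n+2+1) →L[ℝ] ℝ) ∞ fun x => innerSL ℝ (u x) :=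
      ((innerSL ℝ (E := 𝔼 (n+2+1))).contDiff.of_le le_top).comp_contMDiff huc
    exact (contMDiff_norProj hf hf').sub
      (((isBoundedBilinearMap_smulRight (𝕜 := ℝ) (E := 𝔼 (n+2+1)) (F := 𝔼 (n+2+1))).contDiff.of_le
        le_top).comp_contMDiff (h4.prodMk_space huc))
  -- `P_x` fixes `t₀ x`, maps into `ν_x ∩ (u x)ᗮ`, and does not increase norms
  have hPt₀ : ∀ x, P x (t₀ x) = t₀ x := fun x => by
    rw [hPapply, ht₀Q, hut₀, zero_smul, sub_zero]
  have hPQ : ∀ x z, norProj n f x (P x z) = P x z := fun x z => by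
    rw [hPapply, map_sub, map_smul, norProj_norProj, huQ]
  have hPu : ∀ x z, ⟪P x z, u x⟫ = 0 := fun x z => by
    have h1 : ⟪norProj n f x z, u x⟫ = ⟪z, u x⟫ := by
      rw [inner_norProj_comm, huQ]
    rw [hPapply, inner_sub_left, inner_smul_left, real_inner_self_eq_norm_sq, hun, h1,
      real_inner_comm]
    simp
  have hPnorm : ∀ x z, ‖P x z‖ ≤ ‖z‖ := by
    intro x z
    -- `‖Q z‖² = ‖P z‖² + ⟪u, Q z⟫²` and `‖Q z‖ ≤ ‖z‖`
    have hdecomp : norProj n f x z = P x z + ⟪u x, z⟫ • u x := by rw [hPapply]; abel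
    have horth : ⟪P x z, ⟪u x, z⟫ • u x⟫ = 0 := by rw [inner_smul_right, hPu, mul_zero]
    have hpy : ‖norProj n f x z‖ ^ 2 = ‖P x z‖ ^ 2 + ‖⟪u x, z⟫ • u x‖ ^ 2 := by
      rw [hdecomp]
      have := norm_add_sq_eq_norm_sq_add_norm_sq_of_inner_eq_zero _ _ horth
      simpa [sq] using this
    have hQ := norm_norProj_le (n := n) (f := f) x z
    nlinarith [norm_nonneg (P x z), norm_nonneg z, norm_nonneg (norProj n f x z),
      sq_nonneg ‖⟪u x, z⟫ • u x‖]
  -- smooth approximation of `t₀` within `1/2`, re-projected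
  obtain ⟨g, hg, -⟩ := ht₀c.exists_contMDiff_approx (𝓡 n) (⊤ : ℕ∞) (ε := fun _ => (1 : ℝ) / 2)
    continuous_const (fun _ => by norm_num)
  set t : M → 𝔼 (n+2+1) := fun x => P x (g x) with ht
  have htc : ContMDiff (𝓡 n) 𝓘(ℝ, 𝔼 (n+2+1)) ∞ t := hPc.clm_apply g.contMDiff
  have htQ : ∀ x, norProj n f x (t x) = t x := fun x => hPQ x (g x)
  have htu : ∀ x, ⟪t x, u x⟫ = 0 := fun x => hPu x (g x)
  have hts : ∀ x, ⟪t x, s x⟫ = 0 := fun x => by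
    have : s x = ‖s x‖ • u x := by
      rw [hu, smul_smul, mul_inv_cancel₀ (norm_ne_zero_iff.2 (hsn x).2), one_smul]
    rw [this, inner_smul_right, htu, mul_zero]
  have ht0 : ∀ x, t x ≠ 0 := by
    intro x h0
    have h1 : ‖t x - t₀ x‖ < 1 / 2 := by
      have : t x - t₀ x = P x (g x - t₀ x) := by rw [map_sub, hPt₀]
      rw [this]
      exact (hPnorm x _).trans_lt (by rw [← dist_eq_norm]; exact hg x)
    rw [h0, zero_sub, norm_neg, ht₀n] at h1
    norm_num at h1
  -- the framing `(s, t)`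
  refine ⟨t, ⟨?_, ?_, fun x v a h => ?_⟩⟩
  · intro i
    fin_cases i
    · exact hs
    · exact htc
  · intro i x
    fin_cases i
    · change ⟪s x, (f x : 𝔼 (n+2+1))⟫ = 0
      rw [← (hsn x).1]; exact inner_norProj_coe x _
    · change ⟪t x, (f x : 𝔼 (n+2+1))⟫ = 0
      rw [← htQ x]; exact inner_norProj_coe x _
  · -- apply `Q_x`: the tangential term dies, then pair with `s x` and with `t x`
    have h2 := congrArg (norProj n f x) h
    rw [map_add, map_sum, norProj_ambientDeriv x, zero_add, map_zero] at h2
    simp only [map_smul, Fin.sum_univ_two, Matrix.cons_val_zero, Matrix.cons_val_one] at h2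
    rw [(hsn x).1, htQ] at h2
    have hs0 : a 0 = 0 := by
      have := congrArg (fun z => ⟪z, s x⟫) h2
      simp only [inner_add_left, inner_smul_left, hts, mul_zero, add_zero, inner_zero_left,
        RCLike.conj_to_real, mul_eq_zero, inner_self_eq_zero] at this
      exact this.resolve_right (hsn x).2
    have ht1 : a 1 = 0 := by
      rw [hs0, zero_smul, zero_add, smul_eq_zero] at h2
      exact h2.resolve_right (ht0 x)
    funext i
    fin_cases i
    · exact hs0
    · exact ht1

/-- **Kirby's Theorem VIII.2 for `Q = S^{n+2}`**: *an oriented closed `n`-manifold smoothly embedded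
in `S^{n+2}` has trivial normal bundle* — a smooth embedding `f : M → 𝕊ⁿ⁺²` of a compact oriented
`n`-manifold (abstract, charted on `ℝⁿ`) admits a normal `2`-framing
(`Literature.Topology.FourManifolds.IsNormalFraming`). (Kirby's hypothesis `[M] = 0 ∈ H_n(Q; ℤ)`
is automatic for `Q = S^{n+2}`; it enters here as "`f(M)` misses a point of the sphere".)
[cite: Kirby1989, Ch. VIII Thm. 2] -/
theorem exists_isNormalFraming_two_of_embedding :
    ∃ fr : Fin 2 → M → 𝔼 (n+2+1), IsNormalFraming (𝓡 n) f fr := by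
  obtain ⟨s, hs, hsn⟩ := exists_contMDiff_normal_of_embedding o hf hf' hinj
  obtain ⟨t, ht⟩ := exists_isNormalFraming_two_of_normal o hf hf' hs hsn
  exact ⟨![s, t], ht⟩

end Main

end Literature.Topology.FourManifolds
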